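import Literature.Barriers.ValiantsHypothesis.BIJL18Thm6Semantics
import Literature.Barriers.ValiantsHypothesis.BIJL18Thm5Holds
import Literature.Computability.AlgebraicComplexity.HomogenisationFormalDegree
import Literature.Computability.AlgebraicComplexity.ZModCircuitIntegerCodes
import Literature.LinearAlgebra.Matrix.PermanentEntryExpansion
import HarnessLib

/-!
# Bläser–Ikenmeyer–Jindal–Lysikov 2018, Thm. 6 — the honest witness codes, and soundness of the
# certificate language for the graph of the `0/1` permanent

File 6 of the route to `BIJL2018_thm6`. Two halves:

* **Soundness** (`mem_permanent01Graph_of_good`): if `⟨z, ⟨bin p, W⟩⟩` satisfies the semantic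
  certificate condition `Thm6Verifier.Good` (`BIJL18Thm6Semantics.lean`), then the identities force
  `wordPoly p n w_n = perPoly (Fin n) 𝔽_p` (`PermanentChain.chain_sound_perPoly`), so the final check
  gives `per A ≡ v (mod p)` with `0 ≤ per A ≤ n! < 2^{n²+2} ≤ p` and `v < p`, whence `v = per A` and `z`
  is in `permanent01Graph` (Kabanets–Impagliazzo 2003, proof of Lemma 11 / Cor. 12, carried out
  modulo `p` as in BIJL's proof of Thm. 5–6, ECCC p.19).
* **Honest codes** (`exists_levelCode`): for a prime `p`, a layout dimension `m`, a level `k ≤ m` and a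
  bound `S ≥ L_{𝔽_p}(per_k)`, an integer circuit code `w` with `wordPoly p m w = cornerPer 𝔽_p m k`,
  formal degree `≤ max k 1`, `m² ≤ |w| ≤ 26·(3Z+1)·(size p + Z + size(m²) + 6)`, `Z = k²S + k + m²`:
  rename `per_k` into the `m × m` layout (`cornerPer_eq_rename`), homogenise with formal degree
  (`ArithCircuit.exists_computes_formalDegree_le`, brick B5), BALLAST with `m²` empty sum gates so that
  the code hosts the `m²` layout variables (`ballast`: value, formal degree, well-formedness, fan-in,
  edge size preserved), lift the `𝔽_p`-constants to `[0, p)` and encode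
  (`ArithCircuit.exists_intCircuit_of_zmod`, brick B6), read back by `CircuitCode.rdCircuit_circuitWord`.

The completeness of the presentation (choice of `p`, witness length) and the assembly of Thm. 6 are
in `BIJL18Thm6Holds.lean`. HONEST FRAMING: bookkeeping for a published CONDITIONAL barrier theorem;
`VP ≠ VNP` is NOT proved and nothing here bears on it.

## References

* M. Bläser, C. Ikenmeyer, G. Jindal, V. Lysikov, STOC 2018 = ECCC TR18-064, Thm. 6 and §6
  [BlaserIkenmeyerJindalLysikov2018].
* V. Kabanets, R. Impagliazzo, STOC 2003, Lemma 11 and proof of Cor. 12 (p. 358) [KabanetsImpagliazzo2003].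
* P. Bürgisser, *Completeness and Reduction in Algebraic Complexity Theory*, Springer 2000, Def. 2.1,
  Rem. 2.2 [Burgisser2000].
-/

noncomputable section

namespace Literature.Barriers.ValiantsHypothesis

namespace Thm6Verifier

open Literature.Computability.Complexity Literature.Computability.AlgebraicComplexity
open Literature.Computability.QuantumComplexity
open _root_.Computability Brick ModularZeroTest PointSeg CircuitCode PermanentChain MvPolynomial ArithCircuit

/-! ### Ballast gates -/

section Ballast

variable {k : Type*} {σ : Type*}

/-- **Ballast**: append `N` empty sum gates (value `0`, never referenced) to a circuit, so that its
code word is long enough to host `N` variables. [cite: Burgisser2000, Def. 2.1] -/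
def ballast (N : ℕ) (P : ArithCircuit k σ) : ArithCircuit k σ :=
  ⟨P.gates ++ List.replicate N (Gate.sum []), P.output⟩

/-- Size of the ballasted circuit. [cite: Burgisser2000, Def. 2.1] -/
theorem size_ballast (N : ℕ) (P : ArithCircuit k σ) : (ballast N P).size = P.size + N := by
  simp [ballast, size]

/-- The value list of an extended gate list extends the value list (generic twin of
`KIReduction.gateValues_append_eq`). [folklore] -/
private theorem gateValues_append_eq' [CommSemiring k] (gs gs' : List (Gate k σ)) :
    ∃ ws : List (MvPolynomial σ k), gateValues (gs ++ gs') = gateValues gs ++ ws ∧ ws.length = gs'.length := by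
  induction gs' using List.reverseRecOn with
  | nil => exact ⟨[], by simp, rfl⟩
  | append_singleton gs' g ih =>
    obtain ⟨ws, hws, hlen⟩ := ih
    refine ⟨ws ++ [g.eval (gateValues (gs ++ gs'))], ?_, by simp [hlen]⟩
    rw [← List.append_assoc, gateValues_append_singleton, hws, List.append_assoc]

/-- The formal-degree list of an extended gate list extends the formal-degree list. [folklore] -/
private theorem gateFormalDegrees_append_eq' (gs gs' : List (Gate k σ)) :
    ∃ ds : List ℕ, gateFormalDegrees (gs ++ gs') = gateFormalDegrees gs ++ ds ∧ ds.length = gs'.length := by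
  induction gs' using List.reverseRecOn with
  | nil => exact ⟨[], by simp, rfl⟩
  | append_singleton gs' g ih =>
    obtain ⟨ds, hds, hlen⟩ := ih
    refine ⟨ds ++ [g.formalDegree (gateFormalDegrees (gs ++ gs'))], ?_, by simp [hlen]⟩
    rw [← List.append_assoc, gateFormalDegrees_append_singleton, hds, List.append_assoc]

/-- **Ballast does not change the value** (well-formed circuits: the output reads an earlier gate).
[cite: Burgisser2000, Def. 2.1] -/
theorem eval_ballast [CommSemiring k] (N : ℕ) {P : ArithCircuit k σ} (hP : P.WellFormed) : (ballast N P).eval = P.eval := by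
  obtain ⟨ws, hws, -⟩ := gateValues_append_eq' P.gates (List.replicate N (Gate.sum []))
  unfold ArithCircuit.eval
  rw [show (ballast N P).gates = P.gates ++ List.replicate N (Gate.sum []) from rfl, hws,
    show (ballast N P).output = P.output from rfl]
  have hout := hP.2
  revert hout
  cases P.output with
  | var i => intro; rfl
  | const c => intro; rfl
  | gate j =>
    intro hj
    simp only [Operand.RefsBelow, size] at hj
    simp only [Operand.eval, List.getD_eq_getElem?_getD]
    rw [List.getElem?_append_left (by rw [gateValues_length]; exact hj)]

/-- **Ballast does not change the formal degree** (well-formed circuits). [cite: Burgisser2006, §2.2] -/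
theorem formalDegree_ballast (N : ℕ) {P : ArithCircuit k σ} (hP : P.WellFormed) :
    (ballast N P).formalDegree = P.formalDegree := by
  obtain ⟨ds, hds, -⟩ := gateFormalDegrees_append_eq' P.gates (List.replicate N (Gate.sum [] : Gate k σ))
  unfold ArithCircuit.formalDegree
  rw [show (ballast N P).gates = P.gates ++ List.replicate N (Gate.sum []) from rfl, hds,
    show (ballast N P).output = P.output from rfl]
  have hout := hP.2
  revert hout
  cases P.output with
  | var i => intro; rfl
  | const c => intro; rfl
  | gate j =>
    intro hj
    simp only [Operand.RefsBelow, size] at hj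
    simp only [Operand.formalDegree, List.getD_eq_getElem?_getD]
    rw [List.getElem?_append_left (by rw [gateFormalDegrees_length]; exact hj)]

/-- **Ballast preserves well-formedness.** [cite: Burgisser2000, Def. 2.1] -/
theorem wellFormed_ballast (N : ℕ) {P : ArithCircuit k σ} (hP : P.WellFormed) : (ballast N P).WellFormed := by
  refine ⟨fun i g hg u hu => ?_, ?_⟩
  · change (P.gates ++ List.replicate N (Gate.sum []))[i]? = some g at hg
    by_cases hi : i < P.gates.length
    · rw [List.getElem?_append_left hi] at hg
      exact hP.1 i g hg u hu
    · rw [List.getElem?_append_right (not_lt.1 hi)] at hg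
      have hg' : g = Gate.sum [] := by
        have := List.getElem?_replicate (a := (Gate.sum [] : Gate k σ)) (n := N) (i := i - P.gates.length)
        rw [this] at hg
        split_ifs at hg
        simp at hg; exact hg.symm
      subst hg'
      simp [ArithCircuit.Gate.args] at hu
  · have hout := hP.2
    rw [size_ballast]
    change P.output.RefsBelow (P.size + N)
    revert hout
    cases P.output with
    | var i => intro; trivial
    | const c => intro; trivial
    | gate j => intro hj; exact Nat.lt_of_lt_of_le hj (Nat.le_add_right _ _)

/-- **Ballast preserves fan-in `≤ 2`.** [cite: Burgisser2000, Def. 2.1] -/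
theorem isFanInTwo_ballast (N : ℕ) {P : ArithCircuit k σ} (hP : P.IsFanInTwo) : (ballast N P).IsFanInTwo := by
  intro g hg
  change g ∈ P.gates ++ List.replicate N (Gate.sum []) at hg
  rcases List.mem_append.1 hg with h | h
  · exact hP g h
  · rw [List.eq_of_mem_replicate h]; simp [ArithCircuit.Gate.fanIn, ArithCircuit.Gate.args]

/-- **Ballast does not change the edge size** (empty gates have no wires). [cite: Burgisser2000, Def. 2.1] -/
theorem edgeSize_ballast (N : ℕ) (P : ArithCircuit k σ) : (ballast N P).edgeSize = P.edgeSize := by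
  simp only [edgeSize, ballast, List.map_append, List.sum_append, List.map_replicate]
  simp [ArithCircuit.Gate.fanIn, ArithCircuit.Gate.args]

end Ballast

/-! ### The corner permanent is the renamed generic permanent -/

/-- The layout embedding of the `k × k` corner into `Fin m × Fin m` (`k ≤ m`). [folklore] -/
def cornerEmb {k m : ℕ} (hk : k ≤ m) (ac : Fin k × Fin k) : Fin m × Fin m := (Fin.castLE hk ac.1, Fin.castLE hk ac.2)

/-- **`cornerPer F m k = rename (corner embedding) (perPoly (Fin k) F)`** (`k ≤ m`).
[cite: KabanetsImpagliazzo2003, Lemma 11 (p. 358)] -/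
theorem cornerPer_eq_rename (F : Type*) [CommRing F] {k m : ℕ} (hk : k ≤ m) :
    cornerPer F m k = rename (cornerEmb hk) (perPoly (Fin k) F) := by
  unfold cornerPer perPoly
  rw [← AlgHom.coe_toRingHom, ← KIReduction.permanent_map']
  congr 1
  ext a c : 2
  simp only [Matrix.map_apply, cornerMat, AlgHom.coe_toRingHom, Matrix.mvPolynomialX_apply, rename_X, cornerEmb]
  rw [show a.val * m + c.val = (Fin.castLE hk a).val * m + (Fin.castLE hk c).val from rfl, varAtFlat_idx]

/-! ### Soundness: a good certificate certifies the permanent -/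

/-- `n! < 2^{n² + 2}` (the permanent of a `0/1` matrix fits below the prime).
[cite: BlaserIkenmeyerJindalLysikov2018, §6 (proof of Thm. 5, step 4: `p > n!`)] -/
theorem factorial_lt_two_pow_bOf (n : ℕ) : n.factorial < 2 ^ bOf n := by
  have h1 : n.factorial ≤ n ^ n := Nat.factorial_le_pow n
  have h2 : n ^ n ≤ (2 ^ n) ^ n := Nat.pow_le_pow_left (Nat.lt_two_pow_self).le n
  rw [← pow_mul, ← sq] at h2
  have h3 : 2 ^ (n ^ 2) < 2 ^ bOf n := Nat.pow_lt_pow_right (by norm_num) (by rw [bOf]; omega)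
  omega

/-- **Under the identities the last matrix polynomial is the generic permanent.**
[cite: KabanetsImpagliazzo2003, proof of Lemma 11 (p. 358)] -/
theorem wordPoly_last_eq_perPoly {p n : ℕ} {W : List Bool} (h0 : wordPoly p n (fstF W) = 1)
    (hstep : ∀ i < n, wordPoly p n (fstF (sndF^[i + 1] W)) = levelRHS (ZMod p) n i (wordPoly p n (fstF (sndF^[i] W)))) :
    wordPoly p n (fstF (sndF^[n] W)) = perPoly (Fin n) (ZMod p) :=
  chain_sound_perPoly (fun i => wordPoly p n (fstF (sndF^[i] W))) h0 hstep

/-- **Soundness of the certificate language**: a record `⟨z, ⟨bin p, W⟩⟩` satisfying `Good` has a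
canonical instance `z = ⟨⟨A⟩, bin v⟩` with `v = per A` — so `z ∈ permanent01Graph`. (Identities ⇒
`wordPoly w_n = per`; final check ⇒ `per A ≡ v (mod p)`; `0 ≤ per A ≤ n! < 2^{n²+2} ≤ p`, `v < p`.)
[cite: BlaserIkenmeyerJindalLysikov2018, Thm. 6 (proof, §6 p.19)] [cite: KabanetsImpagliazzo2003, Lemma 11 and proof of Cor. 12 (p. 358)] -/
theorem mem_permanent01Graph_of_good {z pb W : List Bool} (hg : Good z pb W) : z ∈ permanent01Graph := by
  obtain ⟨h1, h2, h3, h4, -, -, h7, h8, h9⟩ := hg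
  set x := boolPair z (boolPair pb W) with hx
  set n := KIReduction.nOf x with hn
  set p := bitsToNat pb with hp
  set v := KIReduction.vOf x with hv
  haveI : Fact p.Prime := ⟨h2⟩
  have hz : z = KIReduction.canonX x := by rw [← h1, hx, fstF_boolPair]
  rw [KIReduction.canonX] at hz
  -- the final check, through the identities, is `per (parsedM) ≡ v (mod p)`
  have hlast := wordPoly_last_eq_perPoly h7 h8
  rw [hlast, PermanentChain.eval_perPoly] at h9
  set M : Fin n → Fin n → ℤ := KIReduction.parsedM x with hM
  have hM01 : ∀ a c, M a c = 0 ∨ M a c = 1 := KIReduction.parsedM_zero_one x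
  have hmat : (Matrix.of fun a c : Fin n => (((KIReduction.parsedEntry (KIReduction.rowsStr x) a.val c.val : ℤ)) : ZMod p)) =
      (Matrix.of M).map (Int.castRingHom (ZMod p)) := by
    ext a c; rfl
  rw [show (fun a b : Fin n => ((fun ac : Fin n × Fin n =>
      ((KIReduction.parsedEntry (KIReduction.rowsStr x) ac.1.val ac.2.val : ℤ) : ZMod p)) (a, b))) =
      fun a c : Fin n => ((KIReduction.parsedEntry (KIReduction.rowsStr x) a.val c.val : ℤ) : ZMod p) from rfl,
    hmat, KIReduction.permanent_map', eq_intCast] at h9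
  -- both sides are in `[0, p)`
  have hper0 : 0 ≤ (Matrix.of M).permanent :=
    Matrix.permanent_nonneg_of_nonneg _ fun a c => by rcases hM01 a c with h | h <;> simp [h]
  have hperle : (Matrix.of M).permanent ≤ n.factorial := by
    have := Matrix.permanent_le_factorial (Matrix.of M) (fun a c => by rcases hM01 a c with h | h <;> simp [h])
      (fun a c => by rcases hM01 a c with h | h <;> simp [h])
    simpa using this
  have hperlt : (Matrix.of M).permanent < p := by
    have := factorial_lt_two_pow_bOf n
    have h4' : (2 : ℤ) ^ bOf n ≤ p := by exact_mod_cast h4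
    calc (Matrix.of M).permanent ≤ n.factorial := hperle
      _ < 2 ^ bOf n := by exact_mod_cast this
      _ ≤ p := h4'
  have heq : (Matrix.of M).permanent = v := by
    have h9' : ((Matrix.of M).permanent : ZMod p) = ((v : ℤ) : ZMod p) := by rw [h9]; simp
    rw [ZMod.intCast_eq_intCast_iff', Int.emod_eq_of_lt hper0 hperlt,
      Int.emod_eq_of_lt (by positivity) (by exact_mod_cast h3)] at h9'
    exact h9'
  refine ⟨n, M, hM01, ?_⟩
  rw [hz, heq, Int.toNat_natCast]

/-- **A witnessed instance is in the graph** (`⟨z, u⟩ ∈ L′ ⇒ z ∈ permanent01Graph`).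
[cite: BlaserIkenmeyerJindalLysikov2018, Thm. 6 (proof, §6 p.19)] -/
theorem mem_permanent01Graph_of_mem_semLang {z u : List Bool} (h : boolPair z u ∈ semLang) : z ∈ permanent01Graph := by
  obtain ⟨z', pb, W, he, hg⟩ := h
  have := boolPair_injective (a₁ := (z, u)) (a₂ := (z', boolPair pb W)) he
  simp only [Prod.mk.injEq] at this
  obtain ⟨rfl, -⟩ := this
  exact mem_permanent01Graph_of_good hg

/-! ### The honest code of one level -/

/-- **The honest code of level `k`.** For a prime `p`, a layout dimension `m`, `k ≤ m` and a bound
`S` on `L_{𝔽_p}(per_k)`, there is an integer circuit code `w` whose matrix polynomial is the corner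
permanent `cornerPer 𝔽_p m k`, of formal degree `≤ max k 1`, long enough to host the `m²` layout
variables and of length `≤ 26·(3Z+1)·(size p + Z + size (m²) + 6)`, `Z = k²S + k + m²`.
[cite: BlaserIkenmeyerJindalLysikov2018, §6 (proof of Thm. 5, steps 1–2; Thm. 24 over `𝔽_p`)]
[cite: Burgisser2000, Def. 2.1 and Rem. 2.2] -/
theorem exists_levelCode (p : ℕ) [Fact p.Prime] {m k : ℕ} (hk : k ≤ m) {S : ℕ}
    (hS : complexity (perPoly (Fin k) (ZMod p)) ≤ S) :
    ∃ w : List Bool, wordPoly p m w = cornerPer (ZMod p) m k ∧ (rdCircuit w.length w).formalDegree ≤ max k 1 ∧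
      m * m ≤ w.length ∧
      w.length ≤ 26 * (3 * (k ^ 2 * S + k + m * m) + 1) * (p.size + (k ^ 2 * S + k + m * m) + (m * m).size + 6) := by
  -- the renamed permanent in `m²` flat variables
  let ι : Fin k × Fin k → Fin (m * m) := fun ac =>
    ⟨(Fin.castLE hk ac.1).val * m + (Fin.castLE hk ac.2).val, KIReduction.idx_lt (Fin.castLE hk ac.1).isLt (Fin.castLE hk ac.2).isLt⟩
  set G : MvPolynomial (Fin (m * m)) (ZMod p) := rename ι (perPoly (Fin k) (ZMod p)) with hG
  have hGc : complexity G ≤ S := (complexity_rename_le_holds' ι _).trans hS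
  have hGd : G.totalDegree ≤ k := by
    refine (totalDegree_rename_le _ _).trans ?_
    have := (perPoly_isHomogeneous (n := Fin k) (k := ZMod p)).totalDegree_le
    rwa [Fintype.card_fin] at this
  -- homogenise with formal degree (B5), ballast, lift and encode (B6)
  obtain ⟨P, -, hP2, hPwf, hPcomp, hPsize, hPfd⟩ := exists_computes_formalDegree_le G hGc hGd
  set P' := ballast (m * m) P with hP'
  have hP'eval : P'.eval = G := by rw [hP', eval_ballast _ hPwf]; exact hPcomp
  have hP'fd : P'.formalDegree ≤ max k 1 := by rw [hP', formalDegree_ballast _ hPwf]; exact hPfd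
  have hP'size : P'.size = P.size + m * m := size_ballast _ _
  have hP'edge : P'.edgeSize ≤ 2 * P.size := by
    rw [hP', edgeSize_ballast]; exact edgeSize_le_two_mul_size_holds hP2
  obtain ⟨C, -, hCsize, -, hCedge, hCfd, -, hCeval, hClen⟩ := exists_intCircuit_of_zmod (p := p) P'
  have hmw : m * m ≤ (KIReduction.circuitWord (m * m) C).length := by
    have h1 := gates_length_le_length_circuitWord (m * m) C
    have h2 : C.gates.length = P.size + m * m := by rw [← hP'size, ← hCsize]; rfl
    omega
  refine ⟨KIReduction.circuitWord (m * m) C, ?_, ?_, hmw, ?_⟩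
  · -- the matrix polynomial
    rw [wordPoly, rdCircuit_circuitWord hmw, eval_rename_apply, map_rename, hCeval, hP'eval, hG, aeval_rename,
      aeval_rename, cornerPer_eq_rename (ZMod p) hk]
    have hfun : (aeval (((fun kk : Fin (KIReduction.circuitWord (m * m) C).length => varAtFlat (ZMod p) m kk.val) ∘
        Fin.castLE hmw) ∘ ι) : MvPolynomial (Fin k × Fin k) (ZMod p) →ₐ[ZMod p] MvPolynomial (Fin m × Fin m) (ZMod p)) =
        MvPolynomial.rename (cornerEmb hk) := by
      refine MvPolynomial.algHom_ext fun ac => ?_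
      rw [aeval_X, rename_X, Function.comp_apply, Function.comp_apply, cornerEmb]
      simp only [Fin.val_castLE]
      exact varAtFlat_idx (Fin.castLE hk ac.1) (Fin.castLE hk ac.2)
    exact congrArg (fun φ : MvPolynomial (Fin k × Fin k) (ZMod p) →ₐ[ZMod p] MvPolynomial (Fin m × Fin m) (ZMod p) =>
      φ (perPoly (Fin k) (ZMod p))) hfun
  · -- the formal degree
    rw [rdCircuit_circuitWord hmw, formalDegree_rename, hCfd]; exact hP'fd
  · -- the length
    refine hClen.trans ?_
    have hZ : P'.size ≤ k ^ 2 * S + k + m * m := by rw [hP'size]; omega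
    have hss : P'.size.size ≤ P'.size := Nat.size_le.2 (Nat.lt_two_pow_self)
    exact Nat.mul_le_mul (Nat.mul_le_mul_left _ (by omega)) (by omega)

/-- **The honest code of level `0`**: `per_0 = 1` has complexity `0`. [cite: Burgisser2000, Def. 2.1] -/
theorem complexity_perPoly_zero (p : ℕ) : complexity (perPoly (Fin 0) (ZMod p)) = 0 := by
  have h : perPoly (Fin 0) (ZMod p) = C 1 := by
    rw [perPoly, Matrix.permanent_isEmpty, C_1]
  rw [h]; exact complexity_C_holds _

end Thm6Verifier

end Literature.Barriers.ValiantsHypothesis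

end
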